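import Summits.Ventures.PercRepro2.CaseOneStarPoly

/-!
# The marked star: the vanishing block `(2,1)`
(blind cell PercRepro2, p1 g15; S5 §2.1 (K9) (p))

`eps21 = 2 · Ered(q₁ = 1, q₂ = 1) = 0`: with both root edges open `Q` and `Q ∩ B₂` are impossible, i.e. the
four parts of `Q` and of `QB` sum to zero (`ptQ_sum`, `ptQB_sum`), and `Ered(1, 1) = ΣQ · X − ΣQB · Y` as an
expression in the parts (`linear_combination`). -/

namespace Summit.Ventures.PercRepro2

namespace CaseOne

section Block21
variable {R : Type*} [CommRing R]

/-- With both root edges open, `Q` is impossible: the four parts of `Q` sum to zero. -/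
lemma ptQ_sum (r s : R) (m : SCells R) :
    ptQ00 r s m + ptQ10 r s m + ptQ01 r s m + ptQ11 r s m = 0 := by
  unfold ptQ00 ptQ10 ptQ01 ptQ11
  ring

/-- With both root edges open, `Q ∩ B₂` is impossible: the four parts of `QB` sum to zero. -/
lemma ptQB_sum (r s : R) (m : SCells R) :
    ptQB00 r s m + ptQB10 r s m + ptQB01 r s m + ptQB11 r s m = 0 := by
  unfold ptQB00 ptQB10 ptQB01 ptQB11
  ring

/-- **`eps21 = 0`**. -/
theorem eps21_eq_zero (r s : R) (m : SCells R) : eps21 r s m = 0 := by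
  unfold eps21 cf00 cf01 cf10 cf11 cf20 cf21
  linear_combination (2 : R) * ((1 : R) * ptD00 r s m * ptQABO10 r s m + (-1 : R) * ptDo00 r s m * ptQAB00 r s m + (-1 : R) * ptDo00 r s m * ptQAB10 r s m) * ptQ_sum r s m - (2 : R) * ((1 : R) * ptD00 r s m * ptQAO00 r s m + (1 : R) * ptD00 r s m * ptQAO10 r s m + (-1 : R) * ptDo00 r s m * ptQA00 r s m + (-1 : R) * ptDo00 r s m * ptQA10 r s m) * ptQB_sum r s m

/-- The `(r, s)`-Bernstein form of `eps21`: the block is zero. -/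
theorem eps21_bern (r s : R) (m : SCells R) : 9 * eps21 r s m = (0 : R) := by
  rw [eps21_eq_zero]
  ring

end Block21

end CaseOne

end Summit.Ventures.PercRepro2
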